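import Literature.MathematicalPhysics.QuantumLattice.GrassmannIntegral
import Literature.MathematicalPhysics.QuantumLattice.GaugeGroups
import HarnessLib
import HarnessLib.Audit.Tags

/-!
# QCD conjunct, ladder rung Q1 — the Salmhofer–Seiler small-β conjecture (Y3), TYPED as one
# `@[conjecture] def … : Prop`; nothing is asserted

HONEST FRAMING.  This file ASSERTS NOTHING.  It types ONE open statement about LATTICE `U(N)` gauge
theory with STAGGERED fermions at strong bare coupling (`0 ≤ β < β₀`) and zero mass on finite even
tori: chiral long-range order, uniformly in the volume.  It is NOT in print (searched 2026-08-25: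
cell memo `run/shared/lean/pub/pub-ymgap/qcd-lit/SALMHOFER-SEILER-LOCI.md` §5), it is NOT a
Literature fact (an unproved conjecture never is — human rule 2026-08-15), it is not about `SU(3)`,
Wilson fermions, the continuum, `IsChiralAtZero`, a mass gap, or the Clay problem.  It is the
rung Q1 / Y3 entry of the YM ladder (D-0037): the only rigorous handle on chiral-symmetry-breaking
physics near the tree's `QCD` conjunct is the `β = 0` theorem of Salmhofer–Seiler, and Y3 is its
conjectured extension to small `β > 0`.

WHAT IS PROVED IN PRINT (`β = 0` exactly).  Salmhofer–Seiler, Commun. Math. Phys. 139 (1991)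
395–432 [SalmhoferSeiler1991] (+ Erratum CMP 146 (1992) 637, which only touches Thm. 3.11):
Cor. 4.9 — for `N ≤ 4` and `ν ≥ 4` (and `N = 5`, `ν ≥ 5`) the `U(N)` lattice gauge theory with
staggered fermions at `β = 0`, `m = 0` has chiral long-range order,
`lim_{|x|→∞, ε(x)=-1} (2N)⁻² ⟨ψ̄ψ(0) ψ̄ψ(x)⟩ = 2c₀ > 0` for every infinite-volume limit point (4.43),
with `c₀ ≥ (1/4ν)(1/K(N) − 2S(ν)/N) > 0` uniformly (4.41)–(4.42); engine = the infrared bound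
Thm. 3.21 (in the tree as the cited fact
`Literature.MathematicalPhysics.StatisticalMechanics.SalmhoferSeiler1991_infraredBound`, module
`Literature/MathematicalPhysics/StatisticalMechanics/ComplexSpinInfraredBound.lean`, with the
paper's Remark 4.5 proved there for every `N`) + reflection positivity + a Schwinger–Dyson lower
bound.  In print ABOUT `β > 0`: only the authors' outlook, p. 424: "The known results about
monomer-dimer systems and the techniques used in the proofs, namely the infrared bound and
integration by parts formulas, may suffice to extend … chiral symmetry breaking in the limit as the
mass vanishes to large but finite gauge coupling in compact QED" — an expectation (for `N = 1`),
never followed by a proof (zbMATH/OpenAlex/arXiv/corpus/galaxy searches; Goto–Koma CMP 404 (2023)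
and Fabbri–Goller arXiv:2606.13075 (2026) still describe the result as restricted to `β = 0`).

THE TYPED STATEMENT (finite-volume, uniform form).  For each `N, ν` in the printed range there are
`β₀ > 0`, `c > 0`, `L₀` such that for all `0 ≤ β < β₀` and all even `L ≥ L₀`,
`|Λ_L|⁻¹ ∑_{x ∈ Λ_L} ⟨ψ̄ψ(0) ψ̄ψ(x)⟩_{Λ_L, β, m = 0} ≥ c`,
where `Λ_L = (ℤ/Lℤ)^ν`, the expectation is the honest lattice one — product Haar on `U(N)`-valued
links times `e^{-β S_W(U)}` (the tree's `wilsonWeight`; the normalisation of `β` is immaterial for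
"`∃ β₀ > 0`") times the staggered-fermion Berezin integral, i.e. `det D₀[U]` and the Wick
contraction of `ψ̄ψ(0) ψ̄ψ(x)` with the propagator `D₀[U]⁻¹` (the tree's `staggeredDirac`, periodic
on the torus; for `G = U(N)` the paper's antiperiodic fermion boundary condition gives the SAME
expectations of gauge-invariant observables, by the change of variables multiplying the links that
cross the boundary by the central element `-1 ∈ U(N)`, which preserves Haar measure and every
plaquette).  At `β = 0` the volume average `|Λ|⁻¹ ∑_x ⟨ψ̄ψ(0)ψ̄ψ(x)⟩_Λ = T̂_Λ(0)/|Λ| · (2N)²`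
converges along subsequences to `(2N)² c₀`, the `δ`-mass at `k = 0` of (3.108), so the typed
statement at `β = 0` is exactly the uniform content of the printed proof ((4.41)–(4.42)), and for
`β > 0` it is the natural uniform reading of «chiral LRO for `0 ≤ β < β₀(N, ν)`»; by chiral
symmetry ((2.7), all `β`) only odd sites `ε(x) = -1` contribute to the sum at `m = 0` ((3.101)).
The ONE conjecture `SalmhoferSeilerSmallBeta` asks this for the printed range `1 ≤ N ≤ 4`, `ν ≥ 4`.  The condensate form «`liminf_{m→0⁺} ⟨ψ̄ψ⟩ ≠ 0`» is NOT typed: even at `β = 0` it is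
proved only for `N = 1`/NJL (it needs `m ≠ 0` clustering, Thm. 3.11), Remark 4.10(3).

WHAT A PROOF NEEDS / WHY IT IS OPEN (census S1–S6 of the memo, §6; each step located in print).
S1 at `β = 0` the one-link integrals factorise and bosonise the model into a nearest-neighbour
"complex spin system" with nonnegative Taylor data ((2.16)–(2.23), (4.27), Remark 4.5); at `β > 0`
the effective action is nonlocal and no longer a function of the `ψ̄ψ(x)` (p. 400, p. 404) — a
`β`-polymer representation convergent uniformly in `m ∈ [0, m₀]` and `Λ`, with positivity
bookkeeping, is needed.  S2 reflection positivity of that representation for link reflections (pure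
gauge: Osterwalder–Seiler 1978; staggered Grassmann RP in print only without gauge fields —
Fabbri–Goller 2026 Thm. 2, Goto–Koma 2023 §3).  S3 Gaussian domination / an infrared bound for the
`ψ̄ψ` two-point function at `β > 0` — NO template in print (the research content of Y3).  S4 the
Schwinger–Dyson lower bound `∑_{|y-x|=1} ⟨σ_xσ_y⟩ ≥ 1/K(N) − O(β)` needs volume-uniform bounds
that at `β = 0` come from positivity (3.59).  S5 then `c₀ ≥ (1/4ν)(1/K(N) − 2S(ν)/N) − O(β) > 0`,
i.e. exactly an existential `β₀(N, ν)`.  S6 the condensate `X ≠ 0` would additionally need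
`m ≠ 0` clustering (Heilmann–Lieb zeros), special to `β = 0`, `N = 1`.  Prior gaps for the `QCD`
conjunct itself: `SU(N)` is not covered even at `β = 0` (baryon loops, p. 424); `QCDOf` is typed
with Wilson fermions in the weak-coupling continuum scheme.  BARRIERS catalogued in the tree that
bear on the physics but not on this lattice statement: `Literature/Barriers/QuantumFields/
BanksCasher.lean` (condensate ⇔ spectral density, configuration-wise), `NielsenNinomiya.lean`
(why staggered fermions keep only the `U(1)_ε` remnant of chiral symmetry).

JUNK CONVENTIONS.  `Matrix.inv` of a singular `D₀[U]` is `0`; the set of such `U` is the zero set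
of the real-analytic function `det D₀[U]` on the compact connected group `U(N)^{edges}`, which is
not identically zero (its Haar integral is, up to a positive constant, the `β = 0` partition
function of the complex spin system, positive on even tori), hence Haar-null, so the junk does not
affect the integrals; `det D₀[U] ≥ 0` for every `U` (`D₀` is anti-Hermitian and `ε D₀ ε = -D₀`, so
its spectrum is `{±iλ_j}` and `det D₀ = ∏ λ_j² `), whence `Z_Λ(β, 0) > 0` for every `β` and the
normalised expectation below is a genuine quotient.  Division by `Z = 0` would give `0` (cannot
happen at `m = 0` by the preceding sentence; recorded for completeness).

Cell pub-ymgap, seat qcd-lit g0 (literature-prover), 2026-08-25; director-ym LINE №1 (E); `bears_on: Q1`.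
-/

noncomputable section

open MeasureTheory
open Literature.MathematicalPhysics.QuantumFieldTheory Literature.MathematicalPhysics.QuantumLattice
open Literature.Probability.LatticeModels (TorusSite)

namespace Summit.Ventures.YMGap.Conjectures

/-! ### Lattice `U(N)` gauge theory with staggered fermions on the even torus (finite volume) -/

/-- The gauge group `U(N)` (Mathlib's `Matrix.unitaryGroup (Fin N) ℂ`; compactness, Borel structure
and the normalised Haar measure `haarProbability` from the tree's `GaugeGroups`). [folklore] -/
abbrev UN (N : ℕ) : Type := Matrix.unitaryGroup (Fin N) ℂ

variable (N ν L : ℕ) [NeZero L]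

/-- The staggered Dirac operator of Salmhofer–Seiler (2.3) in the background `U` at mass `m`
(the tree's `staggeredDirac` for the defining representation of `U(N)`: normalisation `½ η_μ(x)`,
periodic on the torus — equivalent to the paper's antiperiodic condition for `G = U(N)`, see the
module docstring). [cite: SalmhoferSeiler1991, (2.3)–(2.4)] -/
def ssDirac (U : GaugeConfig ν L (UN N)) (m : ℝ) :
    Matrix (TorusSite ν L × Fin N) (TorusSite ν L × Fin N) ℂ :=
  staggeredDirac (unitaryFundamentalRep (Fin N) ℂ) U m

/-- The staggered-fermion determinant `det D_m[U]` (the Berezin integral (2.11) of `e^{-S_F}`),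
real part taken (it is real: `≥ 0` at `m = 0`, `> 0` for `m ≠ 0`, by anti-Hermiticity of `D₀` and
the `ε`-symmetry). [cite: SalmhoferSeiler1991, (2.9)–(2.11)] -/
def ssFermionDet (U : GaugeConfig ν L (UN N)) (m : ℝ) : ℝ :=
  (Matrix.det (ssDirac N ν L U m)).re

/-- The Wick contraction of `ψ̄ψ(x) ψ̄ψ(y) = ∑_{a,b} ψ̄_a(x)ψ_a(x) ψ̄_b(y)ψ_b(y)` in the background
`U`: `(tr_c G_{xx})(tr_c G_{yy}) − tr_c(G_{xy} G_{yx})` with `G = D_m[U]⁻¹` (invariant under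
`G ↦ -G` and `G ↦ Gᵀ`, so independent of the sign conventions of the Berezin integral; junk `G = 0`
on the Haar-null set where `D_m[U]` is singular). [cite: SalmhoferSeiler1991, (2.10)–(2.11)] -/
def ssWick (U : GaugeConfig ν L (UN N)) (m : ℝ) (x y : TorusSite ν L) : ℝ :=
  let G := (ssDirac N ν L U m)⁻¹
  ((∑ a : Fin N, G (x, a) (x, a)) * (∑ b : Fin N, G (y, b) (y, b)) -
      ∑ a : Fin N, ∑ b : Fin N, G (x, a) (y, b) * G (y, b) (x, a)).re

/-- The partition function `Z_Λ(β, m) = ∫ e^{-β S_W(U)} det D_m[U] ∏_e dU_e` of `U(N)` lattice gauge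
theory with staggered fermions on the torus `(ℤ/Lℤ)^ν` ((2.9) with the fermions integrated out;
`wilsonWeight` = product Haar × `e^{-β S_W}`, the tree's normalisation of `β`). [cite: SalmhoferSeiler1991, (2.2) and (2.9)] -/
def ssPartitionFunction (β m : ℝ) : ℝ :=
  ∫ U, ssFermionDet N ν L U m ∂(wilsonWeight (d := ν) (L := L) (unitaryFundamentalRep (Fin N) ℂ) β)

/-- The two-point function `⟨ψ̄ψ(x) ψ̄ψ(y)⟩_{Λ, β, m}` of the chiral order field ((2.10), (2.14)):
`Z⁻¹ ∫ e^{-β S_W(U)} det D_m[U] · Wick_{xy}(U) ∏ dU`. [cite: SalmhoferSeiler1991, (2.10) and (2.14)] -/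
def ssTwoPoint (β m : ℝ) (x y : TorusSite ν L) : ℝ :=
  (∫ U, ssFermionDet N ν L U m * ssWick N ν L U m x y
      ∂(wilsonWeight (d := ν) (L := L) (unitaryFundamentalRep (Fin N) ℂ) β)) /
    ssPartitionFunction N ν L β m

/-- The finite-volume chiral long-range-order parameter at zero mass:
`|Λ_L|⁻¹ ∑_{x ∈ Λ_L} ⟨ψ̄ψ(0) ψ̄ψ(x)⟩_{Λ_L, β, m = 0}` (`= (2N)² T̂_Λ(0)/|Λ|` in the notation of
(3.105); its subsequential limits at `β = 0` are `(2N)² c₀`, (3.108)). [cite: SalmhoferSeiler1991, (3.105)–(3.108) and (4.43)] -/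
def ssChiralOrder (β : ℝ) : ℝ :=
  ((L : ℝ) ^ ν)⁻¹ * ∑ x : TorusSite ν L, ssTwoPoint N ν L β 0 0 x

/-! ### The conjecture -/

/-- **CONJECTURE Y3 (ladder rung Q1) — Salmhofer–Seiler at small `β > 0`: chiral long-range order at
strong coupling, uniformly in the volume.**  For the printed range `1 ≤ N ≤ 4`, `ν ≥ 4` of Cor. 4.9
there are `β₀ = β₀(N, ν) > 0`, `c > 0` and `L₀` such that for every `0 ≤ β < β₀` and every even
`L ≥ L₀` the `U(N)` lattice gauge theory with massless staggered fermions on `(ℤ/Lℤ)^ν` satisfies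
`|Λ_L|⁻¹ ∑_x ⟨ψ̄ψ(0) ψ̄ψ(x)⟩_{Λ_L, β, m = 0} ≥ c`.  At `β = 0` this is the uniform content of the
printed proof of Cor. 4.9 ((4.41)–(4.43)); for `β > 0` it is NOT IN PRINT — stated as an
expectation for compact QED (`N = 1`) by the authors, p. 424; the what-breaks census S1–S6 is in
the module docstring.  An obligation node: provable or refutable by name; never a vendored fact;
nothing about `SU(3)`, Wilson fermions, the continuum or a mass gap.
[cite: SalmhoferSeiler1991, §5 p. 424 (outlook) with Cor. 4.9 and (4.41)–(4.43)] -/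
@[conjecture] def SalmhoferSeilerSmallBeta : Prop :=
  ∀ N ν : ℕ, 1 ≤ N → N ≤ 4 → 4 ≤ ν →
    ∃ β₀ : ℝ, 0 < β₀ ∧ ∃ c : ℝ, 0 < c ∧ ∃ L₀ : ℕ, ∀ β : ℝ, 0 ≤ β → β < β₀ →
      ∀ (L : ℕ) [NeZero L], Even L → L₀ ≤ L → c ≤ ssChiralOrder N ν L β

end Summit.Ventures.YMGap.Conjectures

end
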